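import Summits.AtomisticToContinuum.HydrodynamicLimit.Theorems.RelayRaceLocalityNearConstantShortTimeHLEntropyToLLN
import Summits.AtomisticToContinuum.HydrodynamicLimit.Theorems.ImplosionDichotomyHsEosLowDensity
import Summits.AtomisticToContinuum.HydrodynamicLimit.Theorems.JaynesSqueezeHardSphereLDAEos
import Summits.AtomisticToContinuum.HydrodynamicLimit.Theorems.VitaliAmplitudeTransferAmplitudeTransferIdentification
import HarnessLib

/-!
# Crux `NearConstantShortTimeHL` (stmt-AtomisticToContinuum-12502), line `means-pin-entropy` — typed statements and the engine bridge

Support file for the crux `…Theses.RelayRaceLocality.NearConstantShortTimeHL` (near-constant short-time hydrodynamic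
limit for general diameter/number families), line `means-pin-entropy` (skeleton
`Cruxes/NearConstantShortTimeHL/Lines/means_pin_entropy.lean`, lead prover-line-stmt-AtomisticToContinuum-12502-a1-0).
It declares, VERBATIM from the registered skeleton, the four typed statements the line's stubs are about, so that
the stub files (`…GeneralFamilyLDA.lean`, `…GeneralFamilyConcentration.lean`, `…MeansPin.lean`, the engine bridge)
can import ONE set of names:

* `GeneralFamilyLDA` — S1, the local density approximation of the canonical dilute hard-sphere gas for general
  `(ε_N, n_N)` families (pressure per particle and the static mean of the log-profile of the matched local Gibbs law);
* `GeneralFamilyConcentration` — S2, exponential concentration of the three empirical fields under the matched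
  local Gibbs laws, general families (the shape of the reference clause of `NearConstantRelEntropy`);
* `OneMeanLowerBound` — S3, the ENGINE SLOT: the crux's frame verbatim with the conclusion replaced by the one-sided
  lower bound for the time-`t` mean of the log-profile `Λ_t` of the Euler-matched local Gibbs law;
* `MeansConverge` — the dock currency of the engine line `small-tilt-domination` (`MeansConverge` of
  `Cruxes/NearConstantShortTimeHL/Lines/small_tilt_domination.lean`, verbatim): the crux with its conclusion replaced
  by convergence of the EXPECTATIONS of the three fields at `t`.

The composition of the line is `stub_entropyToLLN (stub_meansPin S1 S2 S3)` with `stub_entropyToLLN :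
NearConstantRelEntropy → NearConstantShortTimeHL` LANDED (this directory, `…EntropyToLLN.lean`).

PROVED here (registered sub-goal of the crux item): the ENGINE BRIDGE `oneMeanLowerBound_of_meansConverge :
MeansConverge → OneMeanLowerBound` — the time-`t` mean of the log-profile `Λ_t = A − ‖v − u_t‖²/(2θ_t)` is the
combination `ρ[A − ‖u_t‖²/(2θ_t)] + e[−θ_t⁻¹] + ∑ₗ m[u_{t,l}/θ_t]ₗ` of the three empirical fields with CONTINUOUS test
functions (`integral_logProfile_empiricalMeasure`; continuity of `g_σ ∘ ρ_t` inside the analytic band of the equation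
of state, `hsEosLowDensity_proof` + `HardSphereLDA.eos_calculus`, is why the bridge shrinks `η₀` to `min η₀ η_c`), the
expectations converge by `MeansConverge`, and the limits add up pointwise to `ρ_t (A − 3/2)`
(`logProfile_limit_integrand`) — no mass normalisation, no dynamics (`eventually_logProfileMean_ge`).
References: H.-T. Yau, Lett. Math. Phys. 22 (1991) §2; S. Olla – S.R.S. Varadhan – H.-T. Yau, Comm. Math. Phys. 155
(1993) §3; E. Pulvirenti – D. Tsagkarogiannis, Comm. Math. Phys. 316 (2012) Thm 2.1 (canonical cluster expansion).
-/

noncomputable section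

namespace Summit.AtomisticToContinuum.HydrodynamicLimit.Theorems.NearConstantShortTimeHL

open scoped BigOperators ENNReal
open MeasureTheory Set Filter
open Literature.MathematicalPhysics.KineticTheory Literature.Analysis.FluidPDE Literature.Analysis.FunctionSpaces

/-- **S1 — LOCAL DENSITY APPROXIMATION FOR GENERAL `(ε_N, n_N)` FAMILIES** (general-family twin of
`JaynesSqueeze.HardSphereLDA` (B), item 13459, plus the static mean of the log-profile). There is a packing threshold
`η₁ > 0` such that for every `σ > 0`, every continuous unit-mass density `ρ₁` with `c ≤ ρ₁` and `ρ₁σ³ ≤ η₁`, all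
continuous `u₁`, `θ₁ > 0`, and every admissible family (`ε_N > 0`, `ε_N → 0`, `n_N ε_N³ → σ³`), writing
`a₁ = ρ₁ e^{g_σ(ρ₁)}` and `Q_N` for the canonical hard-sphere law of `n_N` spheres of diameter `ε_N` with profile
`localGibbsProfile a₁ u₁ θ₁`: (i) `n_N⁻¹ log Z_N → ∫ ρ₁ · ρ₁σ³ f_ex′(ρ₁σ³)` (pressure per particle); (ii) the
empirical mean of the log-profile `Λ₁` is eventually `Q_N`-integrable and its expectation tends to
`∫ ρ₁ (log ρ₁ + g_σ(ρ₁) − 3/2 log(2πθ₁) − 3/2)`. (Normalisation is not asked: `Q_N` is the zero measure or a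
probability measure, `isProbabilityMeasure_particleLaw_iff_ne_zero`, and in the pin `Q_N ≠ 0` exactly when the crux's
`P_N ≠ 0` — same hard-sphere domain.) Static; cluster expansion of the canonical ensemble with slowly varying activity,
constants locally uniform in the packing `n_N ε_N³ → σ³` (the one place where general families cost more than the
conjunct's `(hsDiameter σ N, N+1)`). [cite: PulvirentiTsagkarogiannis2012, Thm 2.1] -/
@[conjecture] def GeneralFamilyLDA : Prop :=
  ∃ η₁ : ℝ, 0 < η₁ ∧ ∀ σ : ℝ, 0 < σ →
    let g : ℝ → ℝ := fun r => hsExcessFreeEnergy (r * σ ^ 3) + r * σ ^ 3 * deriv hsExcessFreeEnergy (r * σ ^ 3);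
    ∀ c : ℝ, 0 < c → ∀ ρ₁ : T3 → ℝ, Continuous ρ₁ → (∀ x, c ≤ ρ₁ x ∧ ρ₁ x * σ ^ 3 ≤ η₁) → ∫ x, ρ₁ x = 1 →
    ∀ (u₁ : T3 → V3) (θ₁ : T3 → ℝ), Continuous u₁ → Continuous θ₁ → (∀ x, 0 < θ₁ x) →
    ∀ (ε : ℕ → ℝ) (n : ℕ → ℕ), (∀ N, 0 < ε N) → Tendsto ε atTop (nhds 0) →
    Tendsto (fun N => (n N : ℝ) * ε N ^ 3) atTop (nhds (σ ^ 3)) →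
    let a₁ : T3 → ℝ := fun x => ρ₁ x * Real.exp (g (ρ₁ x));
    let Λ₁ : T3 × V3 → ℝ := fun y =>
      Real.log (ρ₁ y.1) + g (ρ₁ y.1) - 3 / 2 * Real.log (2 * Real.pi * θ₁ y.1) - ‖y.2 - u₁ y.1‖ ^ 2 / (2 * θ₁ y.1);
    let Q : (N : ℕ) → Measure (Config (n N) (Fin 3) T3) := fun N =>
      (liouville (Torus.geometry (Fin 3)) (n N) (ε N)).withDensity fun z =>
        ENNReal.ofReal (canonicalDensity (Torus.geometry (Fin 3)) (ε N) (n N) (localGibbsProfile a₁ u₁ θ₁) z);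
    Tendsto (fun N => (n N : ℝ)⁻¹ *
        Real.log (canonicalPartition (Torus.geometry (Fin 3)) (ε N) (n N) (localGibbsProfile a₁ u₁ θ₁))) atTop
      (nhds (∫ x, ρ₁ x * (ρ₁ x * σ ^ 3 * deriv hsExcessFreeEnergy (ρ₁ x * σ ^ 3)))) ∧
    (∀ᶠ N in atTop, Integrable (fun z => ∫ y, Λ₁ y ∂(empiricalMeasure z)) (Q N)) ∧
    Tendsto (fun N => ∫ z, (∫ y, Λ₁ y ∂(empiricalMeasure z)) ∂(Q N)) atTop
      (nhds (∫ x, ρ₁ x * (Real.log (ρ₁ x) + g (ρ₁ x) - 3 / 2 * Real.log (2 * Real.pi * θ₁ x) - 3 / 2)))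


/-- **S2 — EXPONENTIAL CONCENTRATION OF THE THREE FIELDS UNDER MATCHED LOCAL GIBBS LAWS, GENERAL FAMILIES**
(general-family twin of `JaynesSqueeze.LocalGibbsConcentrationDilute`, item 13460; conjunct-family analogue
`TwoClocks.UniformLocalGibbsConcentration`, item 14445, PROVED). Same data as S1; for every continuous `χ` and `δ > 0`
there is `C > 0` with, for all `N`, `Q_N`-probability at most `C e^{−n_N/C}` that the empirical density / momentum /
energy field tested against `χ` deviates by more than `δ` from `∫χρ₁`, `∫χρ₁u₁`, `∫χE(ρ₁,u₁,θ₁)` (the shape of the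
reference clause of `NearConstantRelEntropy`). Tilted partition functions + LDA, Gaussian velocities given positions;
finitely many early indices are absorbed in `C` because `n_N → ∞`. [cite: PulvirentiTsagkarogiannis2012, Thm 2.1] -/
@[conjecture] def GeneralFamilyConcentration : Prop :=
  ∃ η₁ : ℝ, 0 < η₁ ∧ ∀ σ : ℝ, 0 < σ →
    let g : ℝ → ℝ := fun r => hsExcessFreeEnergy (r * σ ^ 3) + r * σ ^ 3 * deriv hsExcessFreeEnergy (r * σ ^ 3);
    ∀ c : ℝ, 0 < c → ∀ ρ₁ : T3 → ℝ, Continuous ρ₁ → (∀ x, c ≤ ρ₁ x ∧ ρ₁ x * σ ^ 3 ≤ η₁) → ∫ x, ρ₁ x = 1 →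
    ∀ (u₁ : T3 → V3) (θ₁ : T3 → ℝ), Continuous u₁ → Continuous θ₁ → (∀ x, 0 < θ₁ x) →
    ∀ (ε : ℕ → ℝ) (n : ℕ → ℕ), (∀ N, 0 < ε N) → Tendsto ε atTop (nhds 0) →
    Tendsto (fun N => (n N : ℝ) * ε N ^ 3) atTop (nhds (σ ^ 3)) →
    let a₁ : T3 → ℝ := fun x => ρ₁ x * Real.exp (g (ρ₁ x));
    let Q : (N : ℕ) → Measure (Config (n N) (Fin 3) T3) := fun N =>
      (liouville (Torus.geometry (Fin 3)) (n N) (ε N)).withDensity fun z =>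
        ENNReal.ofReal (canonicalDensity (Torus.geometry (Fin 3)) (ε N) (n N) (localGibbsProfile a₁ u₁ θ₁) z);
    ∀ χ : T3 → ℝ, Continuous χ → ∀ δ : ℝ, 0 < δ → ∃ C : ℝ, 0 < C ∧ ∀ N : ℕ,
      Q N {z | δ < |empiricalDensityField z χ - ∫ x, χ x * ρ₁ x|} ≤
          ENNReal.ofReal (C * Real.exp (-(C⁻¹ * (n N : ℝ)))) ∧
      Q N {z | δ < ‖empiricalMomentumField z χ - ∫ x, (χ x * ρ₁ x) • u₁ x‖} ≤
          ENNReal.ofReal (C * Real.exp (-(C⁻¹ * (n N : ℝ)))) ∧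
      Q N {z | δ < |empiricalEnergyField z χ - ∫ x, χ x * totalEnergyDensity (ρ₁ x) (u₁ x) (θ₁ x)|} ≤
          ENNReal.ofReal (C * Real.exp (-(C⁻¹ * (n N : ℝ))))


/-- **S3 — THE ENGINE SLOT: ONE-SIDED LOWER BOUND FOR ONE MEAN AT TIME `t`** (the crux's own frame verbatim —
`∃ η₀ ∀ M ∃ δ₀ τ₀ ∀` continuous positive profiles `∃ σ₀ ∀ σ < σ₀ ∀` admissible families `∀` classical hs-Euler
solutions `δ₀`-near a constant state at `t = 0` `∀` flows, canonical local Gibbs laws `P_N` probability measures tied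
to the Euler data at `t = 0`, `∀ t < min T τ₀` under the packing / temperature / drift / `C¹` guards on `[0,t]` — with
the crux's conclusion REPLACED by): for the log-profile
`Λ_t(x,v) = log ρ_t(x) + g_σ(ρ_t(x)) − 3/2 log(2π θ_t(x)) − ‖v − u_t(x)‖²/(2 θ_t(x))` of the Euler-matched local Gibbs
law at time `t` and every `κ > 0`, eventually in `N` the empirical mean of `Λ_t` at time `t` is `P_N`-integrable and
`E_{P_N}[n_N⁻¹ ∑ᵢ Λ_t((Φ_N t z)ᵢ)] ≥ ∫ ρ_t (log ρ_t + g_σ(ρ_t) − 3/2 log(2πθ_t) − 3/2) − κ`.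
The matching upper bound is FREE (relative entropy `≥ 0` + isentropy + S1), so given S1/S2 this is EQUIVALENT to the
crux (Yau: `H(f_t | ψ^E_t) = o(n)`); it is implied by the crux plus uniform integrability of the kinetic energy
(conserved, Gaussian at `t = 0`). One real sequence per `t`, one-sided: the dock for an engine (tilt-radius:
analytic continuation in the tilt amplitude; small-tilt-domination: matched-entropy Gronwall with event import).
Not reachable from flow-invariant-law window inputs (a²-floor, `Lines/SketchDead.md`). [cite: Yau1991, §2] [cite: OllaVaradhanYau1993, §3] -/
@[conjecture] def OneMeanLowerBound : Prop :=
  ∃ η₀ : ℝ, 0 < η₀ ∧ ∀ M : ℝ, 0 < M → ∃ δ₀ : ℝ, 0 < δ₀ ∧ ∃ τ₀ : ℝ, 0 < τ₀ ∧ ∀ (a₀ θ₀ : T3 → ℝ) (u₀ : T3 → V3), Continuous a₀ → Continuous θ₀ → Continuous u₀ → (∀ x, 0 < a₀ x) → (∀ x, 0 < θ₀ x) → ∃ σ₀ : ℝ, 0 < σ₀ ∧ ∀ σ : ℝ, 0 < σ → σ < σ₀ → ∀ (ε : ℕ → ℝ) (n : ℕ → ℕ), (∀ N, 0 < ε N)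 → Tendsto ε atTop (nhds 0) → Tendsto (fun N => (n N : ℝ) * ε N ^ 3) atTop (nhds (σ ^ 3)) → ∀ (T : ℝ) (ρ θ : ℝ → T3 → ℝ) (u : ℝ → T3 → V3), IsHardSphereEulerSolution σ T ρ u θ → (∃ (ubar : V3) (θbar : ℝ), ∀ x, |ρ 0 x - 1| ≤ δ₀ ∧ ‖u 0 x - ubar‖ ≤ δ₀ ∧ |θ 0 x - θbar| ≤ δ₀) → ∀ Φ : (N : ℕ) → HardSphereFlow (Torus.geometry (Fin 3)) (ε N) (n N), let P : (N : ℕ) → Measure (Config (n N) (Fin 3) T3) := fun N => particleLaw (Φ N) (canonicalDensity (Torus.geometry (Fin 3)) (ε N) (n N) (localGibbsProfile a₀ u₀ θ₀)); (∀ N, IsProbabilityMeasure (P N)) → (∀ χ : T3 → ℝ, Continuous χ → ∀ δ : ℝ, 0 < δ → Tendsto (fun N => P N {z | δ < |empiricalDensityField ((Φ N).flow 0 z) χ - ∫ x, χ x * ρ 0 x|}) atTop (nhds 0) ∧ Tendsto (fun N => P N {z | δ < ‖empiricalMomentumField ((Φ N).flow 0 z) χ - ∫ x, (χ x * ρ 0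 x) • u 0 x‖}) atTop (nhds 0) ∧ Tendsto (fun N => P N {z | δ < |empiricalEnergyField ((Φ N).flow 0 z) χ - ∫ x, χ x * totalEnergyDensity (ρ 0 x) (u 0 x) (θ 0 x)|}) atTop (nhds 0)) → ∀ t ∈ Set.Ico 0 (min T τ₀), (∀ s ∈ Set.Icc 0 t, ∀ x, ρ s x * σ ^ 3 < η₀ ∧ θ s x ≤ M ∧ M⁻¹ ≤ θ s x ∧ ‖u s x‖ ≤ M ∧ ∀ i : Fin 3, |Torus.partialDeriv i (ρ s) x| ≤ M ∧ ‖Torus.partialDeriv i (u s) x‖ ≤ M ∧ |Torus.partialDeriv i (θ s) x| ≤ M) →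
    let g : ℝ → ℝ := fun r => hsExcessFreeEnergy (r * σ ^ 3) + r * σ ^ 3 * deriv hsExcessFreeEnergy (r * σ ^ 3);
    let Λ : T3 × V3 → ℝ := fun y =>
      Real.log (ρ t y.1) + g (ρ t y.1) - 3 / 2 * Real.log (2 * Real.pi * θ t y.1) - ‖y.2 - u t y.1‖ ^ 2 / (2 * θ t y.1);
    ∀ κ : ℝ, 0 < κ → ∀ᶠ N in atTop,
      Integrable (fun z => ∫ y, Λ y ∂(empiricalMeasure ((Φ N).flow t z))) (P N) ∧
      (∫ x, ρ t x * (Real.log (ρ t x) + g (ρ t x) - 3 / 2 * Real.log (2 * Real.pi * θ t x) - 3 / 2)) - κ ≤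
        ∫ z, (∫ y, Λ y ∂(empiricalMeasure ((Φ N).flow t z))) ∂(P N)


/-- **C⁺ OF THE DOCK — CONVERGENCE OF THE MEANS AT TIME `t`** (the typed target `MeansConverge` of the engine line
`small-tilt-domination`, verbatim): the crux `NearConstantShortTimeHL` up to and including its guards, with the
conclusion "the three empirical fields satisfy the LLN at `t`" replaced by "their EXPECTATIONS under `P_N` at time
`t` converge to `∫χρ_t`, `∫χρ_t u_t`, `∫χE_t` for every continuous `χ`" (with eventual integrability, closing the
Bochner-junk trap). It implies `OneMeanLowerBound` (the engine bridge of this line) and is implied by the crux plus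
uniform integrability of the conserved kinetic energy. [cite: Yau1991, §2] -/
@[conjecture] def MeansConverge : Prop :=
  ∃ η₀ : ℝ, 0 < η₀ ∧ ∀ M : ℝ, 0 < M → ∃ δ₀ : ℝ, 0 < δ₀ ∧ ∃ τ₀ : ℝ, 0 < τ₀ ∧ ∀ (a₀ θ₀ : T3 → ℝ) (u₀ : T3 → V3), Continuous a₀ → Continuous θ₀ → Continuous u₀ → (∀ x, 0 < a₀ x) → (∀ x, 0 < θ₀ x) → ∃ σ₀ : ℝ, 0 < σ₀ ∧ ∀ σ : ℝ, 0 < σ → σ < σ₀ → ∀ (ε : ℕ → ℝ) (n : ℕ → ℕ), (∀ N, 0 < ε N) → Tendsto ε atTop (nhds 0) → Tendsto (fun N => (n N : ℝ) * ε N ^ 3) atTop (nhds (σ ^ 3)) → ∀ (T : ℝ) (ρ θ : ℝ → T3 → ℝ) (u : ℝ → T3 → V3), IsHardSphereEulerSolution σ T ρ u θ → (∃ (ubar : V3) (θbar : ℝ), ∀ x, |ρ 0 x - 1| ≤ δ₀ ∧ ‖u 0 x - ubar‖ ≤ δ₀ ∧ |θ 0 x - θbar| ≤ δ₀) → ∀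 Φ : (N : ℕ) → HardSphereFlow (Torus.geometry (Fin 3)) (ε N) (n N), let P : (N : ℕ) → Measure (Config (n N) (Fin 3) T3) := fun N => particleLaw (Φ N) (canonicalDensity (Torus.geometry (Fin 3)) (ε N) (n N) (localGibbsProfile a₀ u₀ θ₀)); (∀ N, IsProbabilityMeasure (P N)) → (∀ χ : T3 → ℝ, Continuous χ → ∀ δ : ℝ, 0 < δ → Tendsto (fun N => P N {z | δ < |empiricalDensityField ((Φ N).flow 0 z) χ - ∫ x, χ x * ρ 0 x|}) atTop (nhds 0) ∧ Tendsto (fun N => P N {z | δ < ‖empiricalMomentumField ((Φ N).flow 0 z) χ - ∫ x, (χ x * ρ 0 x) • u 0 x‖}) atTop (nhds 0) ∧ Tendsto (fun N => P N {z | δ < |empiricalEnergyField ((Φ N).flow 0 z) χ - ∫ x, χ x * totalEnergyDensity (ρ 0 x) (u 0 x) (θ 0 x)|}) atTop (nhds 0)) → ∀ t ∈ Set.Ico 0 (min T τ₀), (∀ s ∈ Set.Icc 0 t, ∀ x, ρ s x * σ ^ 3 < η₀ ∧ θ s x ≤ M ∧ M⁻¹ ≤ θ s x ∧ ‖u s x‖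 ≤ M ∧ ∀ i : Fin 3, |Torus.partialDeriv i (ρ s) x| ≤ M ∧ ‖Torus.partialDeriv i (u s) x‖ ≤ M ∧ |Torus.partialDeriv i (θ s) x| ≤ M) →
    ∀ χ : T3 → ℝ, Continuous χ →
      (∀ᶠ N : ℕ in atTop,
        Integrable (fun z => empiricalDensityField ((Φ N).flow t z) χ) (P N) ∧
        Integrable (fun z => empiricalMomentumField ((Φ N).flow t z) χ) (P N) ∧
        Integrable (fun z => empiricalEnergyField ((Φ N).flow t z) χ) (P N)) ∧
      Tendsto (fun N => ∫ z, empiricalDensityField ((Φ N).flow t z) χ ∂(P N)) atTop (nhds (∫ x, χ x * ρ t x)) ∧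
      Tendsto (fun N => ∫ z, empiricalMomentumField ((Φ N).flow t z) χ ∂(P N)) atTop
        (nhds (∫ x, (χ x * ρ t x) • u t x)) ∧
      Tendsto (fun N => ∫ z, empiricalEnergyField ((Φ N).flow t z) χ ∂(P N)) atTop
        (nhds (∫ x, χ x * totalEnergyDensity (ρ t x) (u t x) (θ t x)))



/-! ## The engine bridge: convergence of the means at `t` ⟹ the one-mean lower bound -/

section Bridge

open scoped RealInnerProductSpace Topology
open Summit.AtomisticToContinuum.HydrodynamicLimit.Theorems.AmplitudeTransfer (integral_apply_V3)

variable {m : ℕ}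

/-- **The mean of a local Gibbs log-profile is a combination of the three empirical fields.** For functions
`A, θ₁ : 𝕋³ → ℝ` and `u₁ : 𝕋³ → ℝ³` and every configuration `w` (no hypothesis on `θ₁`: Lean's `x/0 = 0`),
`∫ (A(x) − ‖v − u₁(x)‖²/(2θ₁(x))) dμ_w = ρ_w[A − ‖u₁‖²/(2θ₁)] + e_w[−θ₁⁻¹] + ∑ₗ (m_w[u₁ₗ/θ₁])ₗ`, where `ρ_w[χ]`,
`m_w[χ]`, `e_w[χ]` are the empirical density / momentum / energy fields tested against `χ` (expand the square:
`‖v − u‖² = ‖v‖² − 2⟪v, u⟫ + ‖u‖²`, `⟪v, u⟫ = ∑ₗ vₗ uₗ`). [folklore] -/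
theorem integral_logProfile_empiricalMeasure (A θ₁ : T3 → ℝ) (u₁ : T3 → V3) (w : Config m (Fin 3) T3) :
    ∫ y, (A y.1 - ‖y.2 - u₁ y.1‖ ^ 2 / (2 * θ₁ y.1)) ∂(empiricalMeasure w) =
      empiricalDensityField w (fun x => A x - ‖u₁ x‖ ^ 2 / (2 * θ₁ x)) +
        empiricalEnergyField w (fun x => -(θ₁ x)⁻¹) +
        ∑ l, empiricalMomentumField w (fun x => u₁ x l / θ₁ x) l := by
  -- pointwise expansion of the log-profile
  have hpt : ∀ (x : T3) (v : V3), A x - ‖v - u₁ x‖ ^ 2 / (2 * θ₁ x) =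
      (A x - ‖u₁ x‖ ^ 2 / (2 * θ₁ x)) + -(θ₁ x)⁻¹ * (‖v‖ ^ 2 / 2) + ∑ l, u₁ x l / θ₁ x * v l := by
    intro x v
    have hinner : inner ℝ v (u₁ x) = ∑ l, u₁ x l * v l := by
      rw [real_inner_comm]
      simp [PiLp.inner_apply, mul_comm]
    have hsum : ∑ l, u₁ x l / θ₁ x * v l = (θ₁ x)⁻¹ * inner ℝ v (u₁ x) := by
      rw [hinner, Finset.mul_sum]
      exact Finset.sum_congr rfl fun l _ => by rw [div_eq_mul_inv]; ring
    rw [hsum, norm_sub_sq_real]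
    field_simp
    ring
  rw [integral_empiricalMeasure, empiricalDensityField_eq_sum, empiricalEnergyField_eq_sum]
  simp only [empiricalMomentumField_eq_sum, PiLp.smul_apply, WithLp.ofLp_sum, Finset.sum_apply, smul_eq_mul,
    WithLp.ofLp_smul, Pi.smul_apply]
  simp_rw [hpt, Finset.sum_add_distrib, mul_add, Finset.mul_sum]
  rw [Finset.sum_comm]

/-- Pointwise identity behind the limit of the means: with `A` arbitrary, `E = ρ(|u|²/2 + 3θ/2)`,
`(A − |u|²/(2θ))ρ + (−θ⁻¹)E + ∑ₗ (uₗ/θ) ρ uₗ = ρ (A − 3/2)` (`θ ≠ 0`). [folklore] -/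
theorem logProfile_limit_integrand (A r θ₁ : ℝ) (u₁ : V3) (hθ : θ₁ ≠ 0) :
    (A - ‖u₁‖ ^ 2 / (2 * θ₁)) * r + -θ₁⁻¹ * totalEnergyDensity r u₁ θ₁ + ∑ l, u₁ l / θ₁ * r * u₁ l =
      r * (A - 3 / 2) := by
  have hnorm : ‖u₁‖ ^ 2 = ∑ l, u₁ l * u₁ l := by
    rw [PiLp.norm_sq_eq_of_L2]
    exact Finset.sum_congr rfl fun l _ => by rw [Real.norm_eq_abs, sq_abs, sq]
  have hsum : ∑ l, u₁ l / θ₁ * r * u₁ l = r / θ₁ * ‖u₁‖ ^ 2 := by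
    rw [hnorm, Finset.mul_sum]
    exact Finset.sum_congr rfl fun l _ => by ring
  rw [hsum, totalEnergyDensity]
  field_simp
  ring

/-- A coordinate of a continuous `ℝ³`-valued field on `𝕋³` is continuous. [folklore] -/
theorem continuous_apply_V3 {u₁ : T3 → V3} (hu : Continuous u₁) (l : Fin 3) : Continuous fun x => u₁ x l :=
  (EuclideanSpace.proj (𝕜 := ℝ) l).continuous.comp hu

variable {ε : ℕ → ℝ} {n : ℕ → ℕ}

/-- **Core of the engine bridge.** If, under laws `P_N` and flows `Φ_N`, the expectations of the three empirical
fields at time `t` converge (with eventual integrability) to those of continuous fields `(ρ₁, u₁, θ₁)`, `θ₁ ≠ 0`,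
for EVERY continuous test function, then for every continuous `A` and `κ > 0`, eventually in `N` the mean of the
log-profile `A(x) − ‖v − u₁(x)‖²/(2θ₁(x))` at time `t` is `P_N`-integrable and at least `∫ ρ₁ (A − 3/2) − κ`: by
`integral_logProfile_empiricalMeasure` it is the combination of the density field of `A − ‖u₁‖²/(2θ₁)`, the energy
field of `−θ₁⁻¹` and the momentum fields of `u₁ₗ/θ₁`, whose expectations converge to a total of `∫ ρ₁ (A − 3/2)`
(`logProfile_limit_integrand`). [folklore] -/
theorem eventually_logProfileMean_ge
    (Φ : (N : ℕ) → HardSphereFlow (Torus.geometry (Fin 3)) (ε N) (n N))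
    (P : (N : ℕ) → Measure (Config (n N) (Fin 3) T3)) (t : ℝ) {ρ₁ θ₁ A : T3 → ℝ} {u₁ : T3 → V3}
    (hρ : Continuous ρ₁) (hθ : Continuous θ₁) (hA : Continuous A) (hu : Continuous u₁) (hθ0 : ∀ x, θ₁ x ≠ 0)
    (hMC : ∀ χ : T3 → ℝ, Continuous χ →
      (∀ᶠ N : ℕ in atTop,
        Integrable (fun z => empiricalDensityField ((Φ N).flow t z) χ) (P N) ∧
        Integrable (fun z => empiricalMomentumField ((Φ N).flow t z) χ) (P N) ∧
        Integrable (fun z => empiricalEnergyField ((Φ N).flow t z) χ) (P N)) ∧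
      Tendsto (fun N => ∫ z, empiricalDensityField ((Φ N).flow t z) χ ∂(P N)) atTop (𝓝 (∫ x, χ x * ρ₁ x)) ∧
      Tendsto (fun N => ∫ z, empiricalMomentumField ((Φ N).flow t z) χ ∂(P N)) atTop
        (𝓝 (∫ x, (χ x * ρ₁ x) • u₁ x)) ∧
      Tendsto (fun N => ∫ z, empiricalEnergyField ((Φ N).flow t z) χ ∂(P N)) atTop
        (𝓝 (∫ x, χ x * totalEnergyDensity (ρ₁ x) (u₁ x) (θ₁ x))))
    {κ : ℝ} (hκ : 0 < κ) :
    ∀ᶠ N : ℕ in atTop,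
      Integrable (fun z => ∫ y, (A y.1 - ‖y.2 - u₁ y.1‖ ^ 2 / (2 * θ₁ y.1))
        ∂(empiricalMeasure ((Φ N).flow t z))) (P N) ∧
      (∫ x, ρ₁ x * (A x - 3 / 2)) - κ ≤
        ∫ z, (∫ y, (A y.1 - ‖y.2 - u₁ y.1‖ ^ 2 / (2 * θ₁ y.1)) ∂(empiricalMeasure ((Φ N).flow t z))) ∂(P N) := by
  -- the test functions and their continuity
  set χ₁ : T3 → ℝ := fun x => A x - ‖u₁ x‖ ^ 2 / (2 * θ₁ x) with hχ₁
  set χ₂ : T3 → ℝ := fun x => -(θ₁ x)⁻¹ with hχ₂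
  set χ₃ : Fin 3 → T3 → ℝ := fun l x => u₁ x l / θ₁ x with hχ₃
  have h2θ : ∀ x, 2 * θ₁ x ≠ 0 := fun x => mul_ne_zero two_ne_zero (hθ0 x)
  have hχ₁c : Continuous χ₁ := hA.sub (((hu.norm).pow 2).div (continuous_const.mul hθ) h2θ)
  have hχ₂c : Continuous χ₂ := (hθ.inv₀ hθ0).neg
  have hχ₃c : ∀ l, Continuous (χ₃ l) := fun l => (continuous_apply_V3 hu l).div hθ hθ0
  obtain ⟨hI₁, hT₁, -, -⟩ := hMC χ₁ hχ₁c
  obtain ⟨hI₂, -, -, hT₂⟩ := hMC χ₂ hχ₂c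
  have h₃ := fun l => hMC (χ₃ l) (hχ₃c l)
  -- names for the three field functionals at time `t`
  set D : (N : ℕ) → Config (n N) (Fin 3) T3 → ℝ := fun N z => empiricalDensityField ((Φ N).flow t z) χ₁ with hD
  set E : (N : ℕ) → Config (n N) (Fin 3) T3 → ℝ := fun N z => empiricalEnergyField ((Φ N).flow t z) χ₂ with hE
  set Mo : Fin 3 → (N : ℕ) → Config (n N) (Fin 3) T3 → V3 :=
    fun l N z => empiricalMomentumField ((Φ N).flow t z) (χ₃ l) with hMo
  -- the decomposition of the mean of the log-profile
  have hdec : ∀ (N : ℕ) (z : Config (n N) (Fin 3) T3),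
      ∫ y, (A y.1 - ‖y.2 - u₁ y.1‖ ^ 2 / (2 * θ₁ y.1)) ∂(empiricalMeasure ((Φ N).flow t z)) =
        D N z + E N z + ∑ l, Mo l N z l := fun N z =>
    integral_logProfile_empiricalMeasure A θ₁ u₁ _
  -- eventual integrability of the five pieces
  have hIall : ∀ᶠ N : ℕ in atTop, Integrable (D N) (P N) ∧ Integrable (E N) (P N) ∧
      ∀ l, Integrable (Mo l N) (P N) := by
    have h3' : ∀ᶠ N : ℕ in atTop, ∀ l, Integrable (Mo l N) (P N) := by
      refine eventually_all.2 fun l => ?_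
      filter_upwards [(h₃ l).1] with N hN
      exact hN.2.1
    filter_upwards [hI₁, hI₂, h3'] with N hN1 hN2 hN3
    exact ⟨hN1.1, hN2.2.2, hN3⟩
  have hcoordInt : ∀ (N : ℕ) (l : Fin 3), Integrable (Mo l N) (P N) →
      Integrable (fun z => Mo l N z l) (P N) := fun N l h =>
    (ContinuousLinearMap.integrable_comp (EuclideanSpace.proj (𝕜 := ℝ) l) h).congr
      (Eventually.of_forall fun z => rfl)
  -- the expectation of the mean, eventually, as a sum of five expectations
  have hsum : ∀ᶠ N : ℕ in atTop,
      ∫ z, (∫ y, (A y.1 - ‖y.2 - u₁ y.1‖ ^ 2 / (2 * θ₁ y.1)) ∂(empiricalMeasure ((Φ N).flow t z))) ∂(P N) =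
        ∫ z, D N z ∂(P N) + ∫ z, E N z ∂(P N) + ∑ l, (∫ z, Mo l N z ∂(P N)) l := by
    filter_upwards [hIall] with N hN
    obtain ⟨hD1, hE1, hM1⟩ := hN
    have hM2 : ∀ l, Integrable (fun z => Mo l N z l) (P N) := fun l => hcoordInt N l (hM1 l)
    have hS : Integrable (fun z => ∑ l, Mo l N z l) (P N) := integrable_finsetSum _ fun l _ => hM2 l
    have e1 : ∫ z, (D N z + E N z + ∑ l, Mo l N z l) ∂(P N) =
        ∫ z, (D N z + E N z) ∂(P N) + ∫ z, (∑ l, Mo l N z l) ∂(P N) := integral_add (hD1.add hE1) hS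
    have e2 : ∫ z, (D N z + E N z) ∂(P N) = ∫ z, D N z ∂(P N) + ∫ z, E N z ∂(P N) := integral_add hD1 hE1
    have e3 : ∫ z, (∑ l, Mo l N z l) ∂(P N) = ∑ l, ∫ z, Mo l N z l ∂(P N) :=
      integral_finsetSum _ fun l _ => hM2 l
    have e4 : ∑ l, ∫ z, Mo l N z l ∂(P N) = ∑ l, (∫ z, Mo l N z ∂(P N)) l :=
      Finset.sum_congr rfl fun l _ => (integral_apply_V3 (hM1 l) l).symm
    simp_rw [hdec N]
    rw [e1, e2, e3, e4]
  -- the limit of the five expectations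
  have hρu : ∀ l, Integrable (fun x => (χ₃ l x * ρ₁ x) • u₁ x) volume := fun l =>
    integrable_of_continuous_T3 (((hχ₃c l).mul hρ).smul hu)
  have hlim : Tendsto (fun N : ℕ => ∫ z, D N z ∂(P N) + ∫ z, E N z ∂(P N) + ∑ l, (∫ z, Mo l N z ∂(P N)) l)
      atTop (𝓝 ((∫ x, χ₁ x * ρ₁ x) + (∫ x, χ₂ x * totalEnergyDensity (ρ₁ x) (u₁ x) (θ₁ x)) +
        ∑ l, (∫ x, (χ₃ l x * ρ₁ x) • u₁ x) l)) := by
    refine (hT₁.add hT₂).add (tendsto_finsetSum _ fun l _ => ?_)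
    exact ((EuclideanSpace.proj (𝕜 := ℝ) l).continuous.tendsto _).comp (h₃ l).2.2.1
  -- the value of the limit
  have hval : (∫ x, χ₁ x * ρ₁ x) + (∫ x, χ₂ x * totalEnergyDensity (ρ₁ x) (u₁ x) (θ₁ x)) +
      ∑ l, (∫ x, (χ₃ l x * ρ₁ x) • u₁ x) l = ∫ x, ρ₁ x * (A x - 3 / 2) := by
    have hi1 : Integrable (fun x => χ₁ x * ρ₁ x) volume := integrable_of_continuous_T3 (hχ₁c.mul hρ)
    have hEc : Continuous fun x => totalEnergyDensity (ρ₁ x) (u₁ x) (θ₁ x) := by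
      unfold totalEnergyDensity
      exact hρ.mul (((hu.norm.pow 2).div_const 2).add (continuous_const.mul hθ))
    have hi2 : Integrable (fun x => χ₂ x * totalEnergyDensity (ρ₁ x) (u₁ x) (θ₁ x)) volume :=
      integrable_of_continuous_T3 (hχ₂c.mul hEc)
    have hi3 : ∀ l, Integrable (fun x => χ₃ l x * ρ₁ x * u₁ x l) volume := fun l =>
      integrable_of_continuous_T3 (((hχ₃c l).mul hρ).mul (continuous_apply_V3 hu l))
    have hcoord : ∀ l, (∫ x, (χ₃ l x * ρ₁ x) • u₁ x) l = ∫ x, χ₃ l x * ρ₁ x * u₁ x l := fun l => by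
      rw [integral_apply_V3 (hρu l) l]
      rfl
    have hS : Integrable (fun x => ∑ l, χ₃ l x * ρ₁ x * u₁ x l) volume := integrable_finsetSum _ fun l _ => hi3 l
    have e1 : ∑ l, (∫ x, (χ₃ l x * ρ₁ x) • u₁ x) l = ∫ x, (∑ l, χ₃ l x * ρ₁ x * u₁ x l) := by
      rw [integral_finsetSum _ fun l _ => hi3 l]
      exact Finset.sum_congr rfl fun l _ => hcoord l
    have e2 : (∫ x, χ₁ x * ρ₁ x) + (∫ x, χ₂ x * totalEnergyDensity (ρ₁ x) (u₁ x) (θ₁ x)) =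
        ∫ x, (χ₁ x * ρ₁ x + χ₂ x * totalEnergyDensity (ρ₁ x) (u₁ x) (θ₁ x)) := (integral_add hi1 hi2).symm
    have e3 : (∫ x, (χ₁ x * ρ₁ x + χ₂ x * totalEnergyDensity (ρ₁ x) (u₁ x) (θ₁ x))) +
        (∫ x, (∑ l, χ₃ l x * ρ₁ x * u₁ x l)) =
        ∫ x, (χ₁ x * ρ₁ x + χ₂ x * totalEnergyDensity (ρ₁ x) (u₁ x) (θ₁ x) + ∑ l, χ₃ l x * ρ₁ x * u₁ x l) :=
      (integral_add (hi1.add hi2) hS).symm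
    rw [e1, e2, e3]
    refine integral_congr_ae (Eventually.of_forall fun x => ?_)
    exact logProfile_limit_integrand (A x) (ρ₁ x) (θ₁ x) (u₁ x) (hθ0 x)
  -- conclusion
  rw [hval] at hlim
  have hlim' := hlim.congr' (hsum.mono fun N h => h.symm)
  have hlow : ∀ᶠ N : ℕ in atTop, (∫ x, ρ₁ x * (A x - 3 / 2)) - κ <
      ∫ z, (∫ y, (A y.1 - ‖y.2 - u₁ y.1‖ ^ 2 / (2 * θ₁ y.1)) ∂(empiricalMeasure ((Φ N).flow t z))) ∂(P N) :=
    hlim'.eventually (lt_mem_nhds (by linarith))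
  filter_upwards [hIall, hlow] with N hN hlowN
  obtain ⟨hD1, hE1, hM1⟩ := hN
  refine ⟨?_, hlowN.le⟩
  have hM2 : ∀ l, Integrable (fun z => Mo l N z l) (P N) := fun l => hcoordInt N l (hM1 l)
  have heq : (fun z => ∫ y, (A y.1 - ‖y.2 - u₁ y.1‖ ^ 2 / (2 * θ₁ y.1))
      ∂(empiricalMeasure ((Φ N).flow t z))) = fun z => D N z + E N z + ∑ l, Mo l N z l :=
    funext (hdec N)
  rw [heq]
  exact (hD1.add hE1).add (integrable_finsetSum _ fun l _ => hM2 l)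

/-- **THE ENGINE BRIDGE** (dock of the engine line `small-tilt-domination` on the engine slot of line
`means-pin-entropy`): convergence of the EXPECTATIONS of the three empirical fields at time `t` (`MeansConverge`)
implies the one-sided lower bound for the time-`t` mean of the log-profile `Λ_t` of the Euler-matched local Gibbs law
(`OneMeanLowerBound`). Witnesses: `η₀ := min η₀ η_c` with `η_c` the analytic band of the equation of state
(`hsEosLowDensity_proof`, `HardSphereLDA.eos_calculus` — inside it `g_σ` is continuous, so that
`A = log ρ_t + g_σ(ρ_t) − 3/2 log(2πθ_t)` is a CONTINUOUS test function), and the `δ₀, τ₀, σ₀` of `MeansConverge`;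
then `eventually_logProfileMean_ge`. No mass normalisation and no dynamics are used. [cite: Yau1991, §2] -/
theorem oneMeanLowerBound_of_meansConverge : MeansConverge → OneMeanLowerBound := by
  rintro ⟨η₁, hη₁, H⟩
  -- the equation of state: `g_σ` is continuous on the analytic band
  obtain ⟨ηE, hηE, F, hFa, hEq, -⟩ := hsEosLowDensity_proof
  obtain ⟨ηc, hηc, -, C, -, hcalc⟩ := HardSphereLDA.eos_calculus hηE hFa hEq
  refine ⟨min η₁ ηc, lt_min hη₁ hηc, fun M hM => ?_⟩
  obtain ⟨δ₀, hδ₀, τ₀, hτ₀, H1⟩ := H M hM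
  refine ⟨δ₀, hδ₀, τ₀, hτ₀, fun a₀ θ₀ u₀ ha hθ hu ha0 hθ0 => ?_⟩
  obtain ⟨σ₀, hσ₀, H2⟩ := H1 a₀ θ₀ u₀ ha hθ hu ha0 hθ0
  refine ⟨σ₀, hσ₀, ?_⟩
  intro σ hσ hσ' ε n hε hε0 hn T ρ θ u hE hnc Φ P hP h0 t ht hg g Λ κ hκ
  have hg' : ∀ s ∈ Icc 0 t, ∀ x, ρ s x * σ ^ 3 < η₁ ∧ θ s x ≤ M ∧ M⁻¹ ≤ θ s x ∧ ‖u s x‖ ≤ M ∧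
      ∀ i : Fin 3, |Torus.partialDeriv i (ρ s) x| ≤ M ∧ ‖Torus.partialDeriv i (u s) x‖ ≤ M ∧
        |Torus.partialDeriv i (θ s) x| ≤ M :=
    fun s hs x => ⟨(hg s hs x).1.trans_le (min_le_left _ _), (hg s hs x).2⟩
  have HM := H2 σ hσ hσ' ε n hε hε0 hn T ρ θ u hE hnc Φ hP h0 t ht hg'
  -- the time-`t` slices
  have htT : t ∈ Ico 0 T := ⟨ht.1, ht.2.trans_le (min_le_left _ _)⟩
  have hρc : Continuous (ρ t) := (hE.smooth_density.isSmooth_slice htT).continuous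
  have huc : Continuous (u t) := (hE.smooth_velocity.isSmooth_slice htT).continuous
  have hθc : Continuous (θ t) := (hE.smooth_temperature.isSmooth_slice htT).continuous
  have hθne : ∀ x, θ t x ≠ 0 := fun x => (hE.temperature_pos t htT x).ne'
  have hρpos : ∀ x, 0 < ρ t x := hE.density_pos t htT
  have hband : ∀ x, ρ t x * σ ^ 3 ≤ ηc := fun x =>
    ((hg t ⟨ht.1, le_rfl⟩ x).1.le.trans (min_le_right _ _))
  -- continuity of `g` on the band, hence of `A`
  obtain ⟨k, k₁, hk⟩ := hcalc σ hσ
  have hgcont : ∀ r, 0 < r → r * σ ^ 3 ≤ ηc → ContinuousAt g r := by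
    intro r hr hrb
    have hd := (hk r hr hrb).2.2.1
    have h1 : ContinuousAt (fun s => (Real.log s + g s) - Real.log s) r :=
      hd.continuousAt.sub (Real.continuousAt_log hr.ne')
    refine h1.congr (Eventually.of_forall fun s => ?_)
    show Real.log s + g s - Real.log s = g s
    ring
  have hgρ : Continuous fun x => g (ρ t x) :=
    continuous_iff_continuousAt.2 fun x => (hgcont _ (hρpos x) (hband x)).comp hρc.continuousAt
  have h2π : ∀ x, 2 * Real.pi * θ t x ≠ 0 := fun x =>
    (mul_pos (mul_pos two_pos Real.pi_pos) (hE.temperature_pos t htT x)).ne'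
  have hAc : Continuous fun x => Real.log (ρ t x) + g (ρ t x) - 3 / 2 * Real.log (2 * Real.pi * θ t x) :=
    ((hρc.log fun x => (hρpos x).ne').add hgρ).sub
      (continuous_const.mul ((continuous_const.mul hθc).log h2π))
  exact eventually_logProfileMean_ge Φ P t hρc hθc hAc huc hθne HM hκ

end Bridge

end Summit.AtomisticToContinuum.HydrodynamicLimit.Theorems.NearConstantShortTimeHL

end
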